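import Summits.ResolutionOfSingularities.ResolutionOfSingularities.Theorems.HilbertSamuelEliminationCampaignW42VertexGame
import Mathlib.Data.Prod.Lex
import Mathlib.Order.WellFounded

/-!
# [OURS · L1 W4.2] The vertex game of the CJS label walk on binomial threefolds — basic API and the RANK
# (proof file 1 of 2 for `…CampaignW42VertexGame.lean`; `--supports stmt-ResolutionOfSingularities-19965`)

HONEST FRAMING. OURS (seat res-L1-s42-pv-2, slot W4.2 / obstruction O2); nothing here is a statement of H. Hironaka's
manuscript [Hironaka2017]; AI-made, AI review is weaker than expert review. A theorem about the validated combinatorial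
MODEL (CALIBRATION-W42-O2-v2/v3), not about schemes; the items 19964/19965 stay OPEN.

CONTENT. (1) Membership / antichain / persistence lemmas for `comps`, `leastClass`, `fresh`, `transform`.
(2) The rank `rank m s = (rho1, arr0, exc0)` in `ℕ ×ₗ ℕ ×ₗ ℕ`: `arr0` = number of oldest components, `exc0` = the sum of
their excesses `a_S − m`, `rho1 = |a| − [arr0 = 1]·exc0` (= the exponent mass OUTSIDE the oldest component `+ m` when the
oldest class is a single component, `|a|` otherwise) — the invariant found and z3-certified this session (kit j272088:
strict lexicographic decrease under every move from every `Good` position, all `m ≥ 1`, all `a ∈ ℕ³`, all labellings,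
charts and unit-forgettings; 5415 cells, 0 counterexamples). (3) `Good m s`: the oldest class is not «plane + disjoint
line» and not «three planes» (the two initial-only shapes). The decrease and the termination theorem are file 2.
-/

set_option linter.dupNamespace false -- mandated namespace of this single-conjunct summit

namespace Summit.ResolutionOfSingularities.ResolutionOfSingularities.Theorems

namespace CampaignW42.VertexGame

open Finset

variable {m : ℕ}

/-! ## Components -/

/-- Membership in `comps`: nonempty, big, and every nonempty proper subset is small. [folklore] -/
theorem mem_comps {a : Fin 3 → ℕ} {S : Finset (Fin 3)} :
    S ∈ comps m a ↔ S.Nonempty ∧ m ≤ ∑ i ∈ S, a i ∧ ∀ T, T ⊂ S → T.Nonempty → ∑ i ∈ T, a i < m := by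
  simp only [comps, mem_filter, mem_univ, true_and, mem_ssubsets]

/-- A component is nonempty. [folklore] -/
theorem nonempty_of_mem_comps {a : Fin 3 → ℕ} {S : Finset (Fin 3)} (h : S ∈ comps m a) : S.Nonempty :=
  (mem_comps.1 h).1

/-- A component is big: `m ≤ a_S`. [folklore] -/
theorem le_sum_of_mem_comps {a : Fin 3 → ℕ} {S : Finset (Fin 3)} (h : S ∈ comps m a) : m ≤ ∑ i ∈ S, a i :=
  (mem_comps.1 h).2.1

/-- Nonempty proper subsets of a component are small. [folklore] -/
theorem sum_lt_of_ssubset {a : Fin 3 → ℕ} {S T : Finset (Fin 3)} (h : S ∈ comps m a) (hT : T ⊂ S)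
    (hne : T.Nonempty) : ∑ i ∈ T, a i < m :=
  (mem_comps.1 h).2.2 T hT hne

/-- Proper subsets of a component are small when `0 < m` (the empty one included). [folklore] -/
theorem sum_lt_of_ssubset' (hm : 0 < m) {a : Fin 3 → ℕ} {S T : Finset (Fin 3)} (h : S ∈ comps m a)
    (hT : T ⊂ S) : ∑ i ∈ T, a i < m := by
  rcases T.eq_empty_or_nonempty with rfl | hne
  · simpa using hm
  · exact sum_lt_of_ssubset h hT hne

/-- The components form an antichain. [folklore] -/
theorem eq_of_subset_of_mem_comps {a : Fin 3 → ℕ} {S T : Finset (Fin 3)} (hS : S ∈ comps m a)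
    (hT : T ∈ comps m a) (h : T ⊆ S) : T = S := by
  by_contra hne
  exact absurd (le_sum_of_mem_comps hT) (not_le.2 (sum_lt_of_ssubset hS (lt_of_le_of_ne h hne)
    (nonempty_of_mem_comps hT)))

/-- A big nonempty set all of whose nonempty proper subsets are small is a component. [folklore] -/
theorem mem_comps_of {a : Fin 3 → ℕ} {S : Finset (Fin 3)} (hne : S.Nonempty) (hbig : m ≤ ∑ i ∈ S, a i)
    (hsmall : ∀ T, T ⊂ S → T.Nonempty → ∑ i ∈ T, a i < m) : S ∈ comps m a :=
  mem_comps.2 ⟨hne, hbig, hsmall⟩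

/-! ## The transform -/

/-- The transformed exponent at the chart coordinate. [folklore] -/
theorem transform_self {a : Fin 3 → ℕ} {U : Finset (Fin 3)} {c : Fin 3} :
    transform m a U c c = ∑ i ∈ U, a i - m := by
  simp [transform]

/-- The other exponents are unchanged. [folklore] -/
theorem transform_ne {a : Fin 3 → ℕ} {U : Finset (Fin 3)} {c i : Fin 3} (h : i ≠ c) :
    transform m a U c i = a i := by
  simp [transform, h]

/-- Sums over index sets avoiding the chart coordinate are unchanged. [folklore] -/
theorem sum_transform_of_not_mem {a : Fin 3 → ℕ} {U S : Finset (Fin 3)} {c : Fin 3} (h : c ∉ S) :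
    ∑ i ∈ S, transform m a U c i = ∑ i ∈ S, a i :=
  Finset.sum_congr rfl fun _ hi => transform_ne (ne_of_mem_of_not_mem hi h)

/-- Sums over index sets containing the chart coordinate: `a'_S + m = a_U + a_{S ∖ c}` (for a big centre). [folklore] -/
theorem sum_transform_of_mem {a : Fin 3 → ℕ} {U S : Finset (Fin 3)} {c : Fin 3} (h : c ∈ S)
    (hU : m ≤ ∑ i ∈ U, a i) :
    ∑ i ∈ S, transform m a U c i + m = ∑ i ∈ U, a i + ∑ i ∈ S.erase c, a i := by
  rw [← Finset.add_sum_erase S _ h, transform_self, sum_transform_of_not_mem (S.notMem_erase c)]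
  omega

/-- A component of the NEW position avoiding the chart coordinate was a component of the old one. [folklore] -/
theorem mem_comps_of_mem_comps_transform {a : Fin 3 → ℕ} {U T : Finset (Fin 3)} {c : Fin 3} (hc : c ∉ T)
    (hT : T ∈ comps m (transform m a U c)) : T ∈ comps m a := by
  obtain ⟨hne, hbig, hsmall⟩ := mem_comps.1 hT
  refine mem_comps_of hne (by rwa [sum_transform_of_not_mem hc] at hbig) fun V hV hVne => ?_
  have := hsmall V hV hVne
  rwa [sum_transform_of_not_mem (fun h => hc (hV.1 h))] at this

/-- A component of the OLD position avoiding the chart coordinate stays a component. [folklore] -/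
theorem mem_comps_transform_of_mem_comps {a : Fin 3 → ℕ} {U T : Finset (Fin 3)} {c : Fin 3} (hc : c ∉ T)
    (hT : T ∈ comps m a) : T ∈ comps m (transform m a U c) := by
  obtain ⟨hne, hbig, hsmall⟩ := mem_comps.1 hT
  refine mem_comps_of hne (by rwa [sum_transform_of_not_mem hc]) fun V hV hVne => ?_
  rw [sum_transform_of_not_mem (fun h => hc (hV.1 h))]
  exact hsmall V hV hVne

/-! ## Labels: the oldest class and fresh labels -/

/-- Membership in the oldest class. [folklore] -/
theorem mem_leastClass {s : State} {S : Finset (Fin 3)} :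
    S ∈ leastClass m s ↔ S ∈ comps m s.a ∧ ∀ T ∈ comps m s.a, s.lab S ≤ s.lab T := by
  simp only [leastClass, mem_filter]

/-- Oldest components are components. [folklore] -/
theorem mem_comps_of_mem_leastClass {s : State} {S : Finset (Fin 3)} (h : S ∈ leastClass m s) :
    S ∈ comps m s.a :=
  (mem_leastClass.1 h).1

/-- A component with the same label as an oldest component is oldest. [folklore] -/
theorem mem_leastClass_of_lab_eq {s : State} {S T : Finset (Fin 3)} (hS : S ∈ leastClass m s)
    (hT : T ∈ comps m s.a) (h : s.lab T = s.lab S) : T ∈ leastClass m s :=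
  mem_leastClass.2 ⟨hT, fun V hV => h ▸ (mem_leastClass.1 hS).2 V hV⟩

/-- A component outside the oldest class is strictly newer than an oldest one. [folklore] -/
theorem lab_lt_of_not_mem_leastClass {s : State} {S T : Finset (Fin 3)} (hS : S ∈ leastClass m s)
    (hT : T ∈ comps m s.a) (h : T ∉ leastClass m s) : s.lab S < s.lab T :=
  lt_of_le_of_ne ((mem_leastClass.1 hS).2 T hT) fun he => h (mem_leastClass_of_lab_eq hS hT he.symm)

/-- Every current component is strictly older than the fresh label. [folklore] -/
theorem lab_lt_fresh {s : State} {S : Finset (Fin 3)} (h : S ∈ comps m s.a) : s.lab S < fresh m s :=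
  Nat.lt_succ_of_le (Finset.le_sup (f := s.lab) h)

/-! ## The rank -/

/-- `|a| = a₀ + a₁ + a₂`, the order of the monomial `x^a`. [folklore] -/
def total (a : Fin 3 → ℕ) : ℕ := ∑ i, a i

/-- `arr0` = the number of oldest components through the point. [folklore] -/
def arr0 (m : ℕ) (s : State) : ℕ := (leastClass m s).card

/-- `exc0` = the sum of the excesses `a_S − m` of the oldest components. [folklore] -/
def exc0 (m : ℕ) (s : State) : ℕ := ∑ S ∈ leastClass m s, (∑ i ∈ S, s.a i - m)

/-- `rho1` = `|a| − exc0` if the oldest class is a single component (= the exponent mass outside it `+ m`), else `|a|`.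
The first key of the invariant: END moves keep it, arrangement moves keep it or lower it, the death of the oldest class
lowers it. [folklore] -/
def rho1 (m : ℕ) (s : State) : ℕ := if arr0 m s = 1 then total s.a - exc0 m s else total s.a

/-- The invariant `(rho1, arr0, exc0)`, ordered lexicographically. [folklore] -/
def rank (m : ℕ) (s : State) : ℕ ×ₗ ℕ ×ₗ ℕ := toLex (rho1 m s, toLex (arr0 m s, exc0 m s))

/-- `Good` positions: the oldest class does NOT consist of pairwise... precisely, it is not the case that it contains two
disjoint members AND covers all three coordinates — this excludes exactly the shapes «plane + disjoint line» and «three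
planes», which occur only at the start of a play (`good_of_step`). [folklore] -/
def Good (m : ℕ) (s : State) : Prop :=
  ¬ ((∃ S ∈ leastClass m s, ∃ T ∈ leastClass m s, Disjoint S T) ∧ ∀ x : Fin 3, ∃ R ∈ leastClass m s, x ∈ R)

/-- `rho1 ≤ |a|`. [folklore] -/
theorem rho1_le_total {s : State} : rho1 m s ≤ total s.a := by
  unfold rho1; split_ifs <;> omega

/-- `|a|` splits off any coordinate. [folklore] -/
theorem total_eq_add_sum_erase (a : Fin 3 → ℕ) (c : Fin 3) : total a = a c + ∑ i ∈ univ.erase c, a i :=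
  (Finset.add_sum_erase _ _ (mem_univ c)).symm

/-- The order after a move: `|a'| + a_c + m = |a| + a_U` (big centre `U ∋ c`). [folklore] -/
theorem total_transform {a : Fin 3 → ℕ} {U : Finset (Fin 3)} {c : Fin 3} (hU : m ≤ ∑ i ∈ U, a i) :
    total (transform m a U c) + a c + m = total a + ∑ i ∈ U, a i := by
  have h1 := sum_transform_of_mem (m := m) (a := a) (U := U) (mem_univ c) hU
  have h2 := total_eq_add_sum_erase a c
  unfold total at *
  omega

/-- A sum over a subset is at most the total. [folklore] -/
theorem sum_le_total (a : Fin 3 → ℕ) (S : Finset (Fin 3)) : ∑ i ∈ S, a i ≤ total a :=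
  Finset.sum_le_sum_of_subset_of_nonneg (subset_univ S) fun _ _ _ => Nat.zero_le _

/-- Rank comparison, unfolded. [folklore] -/
theorem rank_lt_iff {s s' : State} : rank m s' < rank m s ↔
    rho1 m s' < rho1 m s ∨ rho1 m s' = rho1 m s ∧
      (arr0 m s' < arr0 m s ∨ arr0 m s' = arr0 m s ∧ exc0 m s' < exc0 m s) := by
  simp only [rank, Prod.Lex.toLex_lt_toLex]

end CampaignW42.VertexGame

end Summit.ResolutionOfSingularities.ResolutionOfSingularities.Theorems
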